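import Literature.MathematicalPhysics.QuantumManyBody.JelliumBoxReduction
import HarnessLib

/-!
# The Lieb–Solovej lower bound from Foldy's law in a small box (the assembly of §9)

Topic `Literature/MathematicalPhysics/QuantumManyBody` (the charged Bose gas, `JelliumBoseGas.foldyLaw`).
[LiebSolovej2001, §9, first paragraph]: "We first prove Foldy's law in a small cube … It then
follows from Lemma 3.3 that
`E₀ ≥ (1+L/ℓ)³γ(4π/3)^{1/3}Aρℓ³(ρ^{1/4} + o(ρ^{1/4})) - const (L/ℓ)²ρ²ℓ⁵ - ω(t)N/(2ℓ)`. Thus, since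
`N = ρL³`, `lim_{L→∞} E₀/N ≥ γ(4π/3)^{1/3}A(ρ^{1/4} + o(ρ^{1/4})) - const ρ^{1/4}ω(t)(ρ^{1/4}ℓ)⁻¹`."

This file performs exactly this step in the tree's vocabulary: the thermodynamic limit `N → ∞`,
`L = (N/ρ)^{1/3}`, in the reduction inequality `chargedGroundStateEnergy_toReal_ge_boxes`
(Lemma 3.3). The outcome, `lowerBoundOne_of_boxBound`, states that the LOWER half of the
hypothesis of `foldyLaw_of_bounds_one` (the unit-coupling Lieb–Solovej bound
[LiebSolovej2001, Thm. 1.1]) follows from a lower bound `B ≤ 0` on the one-box energies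
`inf Spec H^n_ℓ`, uniform in the particle number `n`, with `B/(ρℓ³) - ω/(2ℓ) ≥ -(I₀ + ε)ρ^{1/4}`
— Foldy's law in the small box [LiebSolovej2001, Thm. 9.2 with (9.1)] together with the choice of
the localization function and of `ℓ`, `t` [LiebSolovej2001, §9, (9.?)–end]. What remains of the
lower bound is therefore precisely the hypothesis `BoxFoldyBound` below (a statement about the
Neumann box Hamiltonian (3.9) alone).

* `JelliumBoseGas.lowerBoundOne_of_boxBound` — the assembly.

## References

* [LiebSolovej2001] E. H. Lieb, J. P. Solovej, Commun. Math. Phys. 217 (2001) 127–163, §9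
  (first paragraph) and Lemma 3.3 (arXiv:cond-mat/0007425, pp. 9, 22).
-/

noncomputable section

open MeasureTheory Set Filter Real Topology
open scoped ENNReal NNReal

namespace Literature.MathematicalPhysics.QuantumManyBody.JelliumBoseGas

open BoseGas

/-- **Foldy's law in the small boxes implies the Lieb–Solovej lower bound**
[LiebSolovej2001, §9]. Hypothesis (Foldy's law in a small cube, in the form produced by
[LiebSolovej2001, Thm. 9.2] and the choice of parameters at the end of §9): for every `ε > 0`
there is a localization function `χ ∈ C_c^∞`, `0 ≤ χ ≤ M`, `χ = 0` off the unit box, `∫χ² ≠ 0`,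
such that for every threshold `ω₀ > 0` and all large `ρ` one can choose `ω ≥ ω₀`, a box size
`ℓ > 0` and a bound `B ≤ 0` with `B ≤ inf Spec H^n_ℓ` for ALL `n` (one-box Hamiltonian (3.9) with
kinetic coefficient `1`, coupling `γ = (∫χ²)⁻¹`, cutoff `χ_ℓ = χ(·/ℓ)`, Yukawa parameter `ω/ℓ`)
and `B/(ρℓ³) - ω/(2ℓ) ≥ (-I₀ - ε)ρ^{1/4}`. Conclusion: the unit-coupling jellium lower bound —
for every `ε > 0`, for all large `ρ`, eventually in `N`,
`(E₀(N, L_N) - shift)/N ≥ (-I₀ - ε)ρ^{1/4}`, `L_N = (N/ρ)^{1/3}` (the `hlow` hypothesis of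
`foldyLaw_of_bounds_one`). Proof: Lemma 3.3 and `N → ∞`. [cite: LiebSolovej2001, §9 with Lemma 3.3] -/
theorem lowerBoundOne_of_boxBound
    (H : ∀ ε : ℝ, 0 < ε → ∃ (χ : Space → ℝ) (M : ℝ), ContDiff ℝ (⊤ : ℕ∞) χ ∧ HasCompactSupport χ ∧
      (∫ u, χ u ^ 2) ≠ 0 ∧ (∀ x, 0 ≤ χ x) ∧ (∀ x, χ x ≤ M) ∧ (∀ x, x ∉ box 1 → χ x = 0) ∧
      ∀ ω₀ : ℝ, 0 < ω₀ → ∃ ρ₀ : ℝ, 0 < ρ₀ ∧ ∀ ρ : ℝ, ρ₀ ≤ ρ → ∃ ω : ℝ, ω₀ ≤ ω ∧ ∃ ℓ : ℝ, 0 < ℓ ∧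
        ∃ B : ℝ, B ≤ 0 ∧
          (∀ n : ℕ, B ≤ boxGroundStateEnergy 1 (∫ u, χ u ^ 2)⁻¹ ρ (fun x => χ (ℓ⁻¹ • x)) (ω / ℓ) n ℓ) ∧
          (-foldyConstant - ε) * ρ ^ (1 / 4 : ℝ) ≤ B / (ρ * ℓ ^ 3) - ω / (2 * ℓ)) :
    ∀ ε : ℝ, 0 < ε → ∃ ρ₀ : ℝ, 0 < ρ₀ ∧ ∀ ρ : ℝ, ρ₀ ≤ ρ → ∀ᶠ N : ℕ in atTop,
      (-foldyConstant - ε) * ρ ^ (1 / 4 : ℝ) ≤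
        ((chargedGroundStateEnergy 0 1 ρ N (sideLength ρ N)).toReal -
            jelliumEnergyShift 1 ρ N (sideLength ρ N)) / N := by
  intro ε hε
  obtain ⟨χ, M, hχ, hsupp, hχ0, hχnn, hχM, hχbox, Hω⟩ := H (ε / 2) (half_pos hε)
  obtain ⟨ω₀, hω₀, RED⟩ := chargedGroundStateEnergy_toReal_ge_boxes hχ hsupp hχ0 hχnn hχM hχbox
  obtain ⟨ρ₀, hρ₀, Hρ⟩ := Hω ω₀ hω₀
  refine ⟨ρ₀, hρ₀, fun ρ hρ => ?_⟩
  have hρpos : 0 < ρ := hρ₀.trans_le hρ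
  obtain ⟨ω, hω, ℓ, hℓ, B, hB0, hB, hgap⟩ := Hρ ρ hρ
  set γ : ℝ := (∫ u, χ u ^ 2)⁻¹ with hγ
  set C : ℝ := (ℓ ^ 3)⁻¹ * (1 * γ * ρ ^ 2 * (3 * π * M ^ 2 * ℓ ^ 5)) with hC
  -- the side length `L_N = (N/ρ)^{1/3} → ∞` and `N = ρ L_N³`
  have hL3 : ∀ N : ℕ, (N : ℝ) = ρ * sideLength ρ N ^ 3 := by
    intro N
    have h : (0 : ℝ) ≤ N / ρ := div_nonneg N.cast_nonneg hρpos.le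
    rw [sideLength, show (1 / 3 : ℝ) = ((3 : ℕ) : ℝ)⁻¹ by norm_num,
      Real.rpow_inv_natCast_pow h three_ne_zero, mul_div_cancel₀ _ hρpos.ne']
  have hLtop : Tendsto (fun N : ℕ => sideLength ρ N) atTop atTop :=
    (tendsto_rpow_atTop (by norm_num : (0 : ℝ) < 1 / 3)).comp
      (tendsto_natCast_atTop_atTop.atTop_div_const hρpos)
  -- the limit of the `N`-dependent part of Lemma 3.3 divided by `N`
  set g : ℝ → ℝ := fun u => (ℓ ^ 3)⁻¹ * B * ρ⁻¹ * (1 + u) ^ 3 -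
    C * ρ⁻¹ * ((1 + u) ^ 3 - (1 - u) ^ 3) with hg
  have hu : Tendsto (fun N : ℕ => ℓ / sideLength ρ N) atTop (𝓝 0) :=
    tendsto_const_nhds.div_atTop hLtop
  have hgc : Continuous g := by
    rw [hg]; fun_prop
  have hg0 : g 0 = B / (ρ * ℓ ^ 3) := by
    rw [hg]
    simp only [add_zero, sub_zero, one_pow, mul_one, sub_self, mul_zero]
    rw [div_eq_mul_inv, mul_inv]
    ring
  have hlim : Tendsto (fun N : ℕ => g (ℓ / sideLength ρ N)) atTop (𝓝 (B / (ρ * ℓ ^ 3))) := by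
    rw [← hg0]
    exact (hgc.tendsto 0).comp hu
  have heq : ∀ᶠ N : ℕ in atTop, ((ℓ ^ 3)⁻¹ * (sideLength ρ N + ℓ) ^ 3 * B -
      C * ((sideLength ρ N + ℓ) ^ 3 - (sideLength ρ N - ℓ) ^ 3)) / N = g (ℓ / sideLength ρ N) := by
    filter_upwards [hLtop.eventually_gt_atTop 0] with N hLpos
    rw [hL3 N, hg]
    field_simp
  have hlim' := hlim.congr' (EventuallyEq.symm heq)
  -- slack: the limit value exceeds the target strictly
  have hρ4 : 0 < ρ ^ (1 / 4 : ℝ) := Real.rpow_pos_of_pos hρpos _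
  have hlt : (-foldyConstant - ε) * ρ ^ (1 / 4 : ℝ) + ω / (2 * ℓ) < B / (ρ * ℓ ^ 3) := by
    nlinarith
  have hev := (tendsto_order.1 hlim').1 _ hlt
  filter_upwards [hev, hLtop.eventually_ge_atTop ℓ, eventually_gt_atTop 0] with N hN hLℓ hNpos
  have hNr : (0 : ℝ) < N := Nat.cast_pos.2 hNpos
  -- Lemma 3.3 with `q = 1`, `Emin = B`
  have hred := RED ω hω ℓ hℓ ρ hρpos.le (sideLength ρ N) hLℓ one_pos hNpos (Emin := B)
    (fun n _ => by simpa only [one_mul] using hB n) hB0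
  rw [le_div_iff₀ hNr]
  have e : ((ℓ ^ 3)⁻¹ * (sideLength ρ N + ℓ) ^ 3 * B -
      C * ((sideLength ρ N + ℓ) ^ 3 - (sideLength ρ N - ℓ) ^ 3)) =
      ((ℓ ^ 3)⁻¹ * (sideLength ρ N + ℓ) ^ 3 * B -
        C * ((sideLength ρ N + ℓ) ^ 3 - (sideLength ρ N - ℓ) ^ 3)) / N * N :=
    (div_mul_cancel₀ _ hNr.ne').symm
  have h1 : ((-foldyConstant - ε) * ρ ^ (1 / 4 : ℝ) + ω / (2 * ℓ)) * N <
      ((ℓ ^ 3)⁻¹ * (sideLength ρ N + ℓ) ^ 3 * B -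
        C * ((sideLength ρ N + ℓ) ^ 3 - (sideLength ρ N - ℓ) ^ 3)) / N * N :=
    mul_lt_mul_of_pos_right hN hNr
  rw [← e] at h1
  have e2 : (1 : ℝ) * (1 / 2 * (ω / ℓ) * N) = ω / (2 * ℓ) * N := by
    field_simp
  rw [hC] at h1
  linarith [hred, h1, e2]

end Literature.MathematicalPhysics.QuantumManyBody.JelliumBoseGas
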